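import Literature.NumberTheory.Automorphic.PairLFunctionMeromorphicContinuationLocalReduction

/-!
# Mœglin–Waldspurger (ii) from the general-test-function global theorem and the general local datum

Summit `Langlands`, sub-problem `Langlands`, helper file under `Theorems/` supporting the crux
`PairLBoundaryJS` (stmt-Langlands-13622, Arthur–Clozel (1989), Ch. 3, (2.2)), line `Sketch`,
registered stub `stub_eq_conj_of_local_gen` (skeleton v8).

`EqConjOfLocalGen.stub_eq_conj_of_local_gen` (**main**) is the tree theorem
`Literature.NumberTheory.Automorphic.MoeglinWaldspurger1989_partialPairL_of_eq_conj_of_local`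
(`PairLFunctionMeromorphicContinuationLocalReduction`; Mœglin–Waldspurger (1989), Appendice,
Corollaire (ii): `s (s - 1) L^S(s, π ⊗ σ)` is entire for `π = σ̄`, from the LOCAL Rankin–Selberg theory)
re-run with a GENERAL test function. What changed: the tree theorem freezes the Schwartz–Bruhat
function of the Rankin–Selberg integrals to the standard one `Φ_∞ ⊗ 𝟙_{𝒪̂ⁿ}` (`standardTestFun`), both
in its local hypothesis `hloc` and in the global input
`exists_entire_eq_mul_partialPairL_mul_setIntegral_pair`. Here both are generalised to any real
`Φ : 𝔸_Kⁿ → ℝ`, `Φ ≥ 0`, continuous, Schwartz–Bruhat, spherical off `S' = S ∪ T`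
(`IsLastRowSphericalAt` and integral support at every `v ∉ S'`) — the printed local theorems
(Jacquet–Piatetski-Shapiro–Shalika (1983), Thm. 2.7; Cogdell (2004), Thm. 3.1, 3.3) choose `Φ_v`
freely at the bad places. The statement is an implication: its first hypothesis is the general-`Φ`
global pair theorem (registered stub `stub_global_pair_gen` of the skeleton: entire `F` with
`F(s) = s (s - 1) I(s; S̄_η f', S_η f, Φ)` for `re s > 1` and
`F(s) = s (s - 1) · C · L^{S'}(s, α ⊗ γ̄) · Ψ_{S'}(s)` on the strip `1 < re s < 2`), its second the
general-`Φ` local datum for the diagonal pairs (registered stub `stub_hloc_eq_conj_gen`), and the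
conclusion is the named fact `MoeglinWaldspurger1989_partialPairL_of_eq_conj`.

Proof: verbatim the tree proof (Cogdell (2004), §4.2, proof of Thm. 4.2 for `m = n`). For the datum
`(P, P', S, α, β)` and `s₀`, with the local data of the second hypothesis for `σ = P'` (Borel
σ-algebra on `𝔸_K`, Haar measures chosen inside), the entire functions `F_i` of the first hypothesis
satisfy `F_i(s) = s (s - 1) · C · L^{S ∪ T}(s, β ⊗ β̄) · Ψ_{S ∪ T, i}(s)` on the strip, so
`J = H · ∑_i c_i F_i` and `C A` satisfy `J = C A · s (s - 1) L^S(s, α ⊗ β)` on the strip by the change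
of `S` (`partialPairL_eq_prod_mul_partialPairL`; `L^S(α ⊗ β) = L^S(β ⊗ β̄)` for `π = σ̄`,
`partialPairL_eq_partialPairL_conjFamily_of_eq_conj`, `partialPairL_comm`,
`JacquetShalika1981_multipliable_partialPairL_holds`), and the glue
`exists_entire_eq_mul_partialPairL_of_quotients_on_strip` concludes; the common central scalars of
`f_i, f'_i ∈ σ` are `CuspidalAutomorphicRepGL.exists_central_scalar`.

## References

* C. Mœglin, J.-L. Waldspurger, *Le spectre résiduel de `GL(n)`*, Ann. Sci. École Norm. Sup. (4)
  22 (1989), 605–674: Appendice, Corollaire (ii), p. 667. [MoeglinWaldspurger1989]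
* J. W. Cogdell, *Analytic theory of `L`-functions for `GL_n`*, in: An Introduction to the
  Langlands Program (Birkhäuser, 2004), §2.3 Thm. 2.1–2.2, §3 Thm. 3.1, 3.3, §4.1–§4.2, Thm. 4.2.
  [CogdellAnalyticTheory2004]
* H. Jacquet, I. I. Piatetski-Shapiro, J. A. Shalika, *Rankin–Selberg convolutions*, Amer. J. Math.
  105 (1983), 367–464, Thm. 2.7. [JPSS1983]
-/

noncomputable section

-- `Summit.Langlands.Langlands.…` (summit = sub-problem name, D-0017 layout) trips `dupNamespace`
set_option linter.dupNamespace false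

open scoped MatrixGroups Topology Pointwise ENNReal NNReal ComplexConjugate InnerProductSpace
open NumberField IsDedekindDomain MeasureTheory Measure Matrix Set Filter
open Literature.NumberTheory.Automorphic AdelicGroupData
open Literature.NumberTheory.GaloisRepresentations (ideleGroup)
open ValuativeRel

-- the automorphic quotient carries the tree's Borel σ-algebra, not Mathlib's quotient σ-algebra
attribute [-instance] Quotient.instMeasurableSpace QuotientGroup.measurableSpace

-- the house local instances, exactly as in `RankinSelbergUnfoldingIdentity`
attribute [local instance] adelicBorel borelSpace_adelic locallyCompactSpace_adelic secondCountableTopology_gl_adelic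
  glAdeleBorel borelSpace_glAdele borelSpace_ideleGroup secondCountableTopology_ideleGroup

namespace Summit.Langlands.Langlands.Theorems.EqConjOfLocalGen

/-- **Mœglin–Waldspurger, Corollaire (ii) (`MoeglinWaldspurger1989_partialPairL_of_eq_conj`) from the
general-test-function global Rankin–Selberg theorem and the general local datum.** Assume (first
hypothesis) the global half of the Rankin–Selberg method for a pair of cusp forms with a GENERAL test
function: a constant `C > 0` (Haar measures) such that for all cuspidal `π ∋ f`, `π' ∋ f'` with common
unitary central scalars, Satake families `α`, `γ` off `S`, test functions `η` of level `K(𝔫₀)`,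
`S' ⊇ S` off which `v ∤ 𝔫₀ 𝔡_K`, enumerations `x`, `y` of `α`, `γ` off `S'`, and every real `Φ ≥ 0`,
continuous, Schwartz–Bruhat, spherical with integral support off `S'`, some ENTIRE `F` has
`F(s) = s (s - 1) I(s; S̄_η f', S_η f, Φ)` for `re s > 1` and
`F(s) = s (s - 1) · C · L^{S'}(s, α ⊗ γ̄) · Ψ_{S'}(s)` for `1 < re s < 2`. Assume (second hypothesis)
the local Rankin–Selberg datum for the diagonal pairs with a general test function: for every cuspidal
`σ`, finite `S` with a Satake family `β` of `σ` off `S`, every `s₀ ∈ ℂ` and all Haar measures, a finite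
`T` disjoint from `S` with `v ∤ 𝔡_K` off `S ∪ T`, pairs `f_i, f'_i ∈ σ`, test functions `η_i` of
levels `𝔫_i ≠ 0` prime to the places off `S ∪ T`, real `Φ_i ≥ 0` continuous Schwartz–Bruhat spherical
with integral support off `S ∪ T`, entire `c_i`, `A`, `H` with `A(s₀) ≠ 0` and
`H(s) · ∑_i c_i(s) Ψ_{S ∪ T}(s; W_{f_i}, W̄_{f'_i}, Φ_i) = A(s) · ∏_{v ∈ T} L(s, σ_v × σ̃_v)` for
`re s > 1`. Then `s (s - 1) L^S(s, π ⊗ σ)` is entire for every `π = σ̄`, finite `S` and honest Satake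
families (the named fact). Verbatim the tree proof
`MoeglinWaldspurger1989_partialPairL_of_eq_conj_of_local` with the test function generalised: Borel
σ-algebra on `𝔸_K` and Haar measures inside, the `F_i` of the first hypothesis for the data of the
second, `J = H · ∑_i c_i F_i`, `A' = C A`, the change of `S` (`partialPairL_eq_prod_mul_partialPairL`,
`L^S(α ⊗ β) = L^S(β ⊗ β̄)`), and the glue `exists_entire_eq_mul_partialPairL_of_quotients_on_strip`.
Cogdell (2004), §4.2, proof of Thm. 4.2 for `m = n`; Mœglin–Waldspurger (1989), Appendice,
Corollaire (ii), p. 667. -/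
theorem stub_eq_conj_of_local_gen :
    (∀ {n : ℕ} {K : Type} [Field K] [NumberField K]
      [MeasurableSpace (AdeleRing (𝓞 K) K)] [BorelSpace (AdeleRing (𝓞 K) K)] (_hn : 0 < n)
      (μ' : Measure (AdelicGroupData.gl n K).automorphicQuotient)
      [(AdelicGroupData.gl n K).IsAutomorphicMeasure μ']
      (νI : Measure (ideleGroup K)) [νI.IsHaarMeasure]
      (νA : Measure (Fin n → ideleGroup K)) [IsHaarMeasure νA]
      (νK : Measure ↥(maximalCompactAdelic n K)) [IsHaarMeasure νK]
      (ν₀ : Measure ↥(adelicUnipotent n K)) [IsHaarMeasure ν₀],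
      ∃ C : ℝ, 0 < C ∧
      ∀ (P Q : CuspidalAutomorphicRepGL n K μ') (f : P.1.toSubmodule) (f' : Q.1.toSubmodule),
      (∀ z : ideleGroup K, ∃ c : ℂ, ‖c‖ = 1 ∧
      (AdelicGroupData.gl n K).rightRegular μ' (Matrix.GeneralLinearGroup.scalar (Fin n) z)
      (f : (AdelicGroupData.gl n K).L2 μ') = c • (f : (AdelicGroupData.gl n K).L2 μ') ∧
      (AdelicGroupData.gl n K).rightRegular μ' (Matrix.GeneralLinearGroup.scalar (Fin n) z)
      (f' : (AdelicGroupData.gl n K).L2 μ') = c • (f' : (AdelicGroupData.gl n K).L2 μ')) →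
      ∀ {S : Set (HeightOneSpectrum (𝓞 K))} {α γ : SatakeFamily K}, IsSatakeFamilyOf P S α →
      IsSatakeFamilyOf Q S γ →
      ∀ {𝔫₀ : Ideal (𝓞 K)}, 𝔫₀ ≠ 0 →
      ∀ {η : (AdelicGroupData.gl n K).Adelic → ℝ}, IsTestFunctionGL n K η →
      (∀ k : (AdelicGroupData.gl n K).Adelic, k ∈ principalCongruenceLevel n K 𝔫₀ →
      ∀ g : (AdelicGroupData.gl n K).Adelic, η (k * g) = η g) →
      ∀ {S' : Set (HeightOneSpectrum (𝓞 K))}, S ⊆ S' →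
      (∀ v ∉ S', ¬ v.asIdeal ∣ 𝔫₀ ∧ ¬ v.asIdeal ∣ differentIdeal ℤ (𝓞 K)) →
      ∀ {x y : HeightOneSpectrum (𝓞 K) → Fin n → ℂ},
      (∀ v ∉ S', (Finset.univ : Finset (Fin n)).val.map (x v) = α v) →
      (∀ v ∉ S', (Finset.univ : Finset (Fin n)).val.map (y v) = γ v) →
      ∀ {Φ : (Fin n → AdeleRing (𝓞 K) K) → ℝ}, Continuous Φ → (∀ y, 0 ≤ Φ y) →
      (fun y => ((Φ y : ℝ) : ℂ)) ∈ piSchwartzBruhat K (Fin n) →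
      (∀ v ∉ S', IsLastRowSphericalAt n K Φ v) →
      (∀ v ∉ S', ∀ y : Fin n → AdeleRing (𝓞 K) K, Φ y ≠ 0 → ∀ j, Valued.v ((y j).2 v) ≤ 1) →
      ∃ F : ℂ → ℂ, Differentiable ℂ F ∧
      (∀ s : ℂ, 1 < s.re → F s = s * (s - 1) *
      rankinSelbergIntegral μ' νI (fun y => ((Φ y : ℝ) : ℂ)) s
      (star (smoothedForm η (f' : (AdelicGroupData.gl n K).L2 μ')))
      (smoothedForm η (f : (AdelicGroupData.gl n K).L2 μ'))) ∧
      (∀ s : ℂ, 1 < s.re → s.re < 2 → F s = s * (s - 1) * ((C : ℂ) *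
      (partialPairL S' α (fun v => (γ v).map conj) s *
      ∫ p in unitBox {v | v ∉ S'} ×ˢ Set.univ, torusPairIntegrandC n K
      (whittakerCoeff ν₀ (unipotentTateDomain n K) (adeleAddChar K)
      (invQuot (AdelicGroupData.gl n K) (smoothedForm η (f : (AdelicGroupData.gl n K).L2 μ'))))
      (star (whittakerCoeff ν₀ (unipotentTateDomain n K) (adeleAddChar K)
      (invQuot (AdelicGroupData.gl n K) (smoothedForm η (f' : (AdelicGroupData.gl n K).L2 μ')))))
      Φ s p ∂(νA.prod νK))))) →
    ∀ {n : ℕ} {K : Type} [Field K] [NumberField K]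
      {μ : Measure (AdelicGroupData.gl n K).automorphicQuotient}
      [(AdelicGroupData.gl n K).IsAutomorphicMeasure μ],
      (∀ [MeasurableSpace (AdeleRing (𝓞 K) K)] [BorelSpace (AdeleRing (𝓞 K) K)]
      (Q : CuspidalAutomorphicRepGL n K μ) {S : Set (HeightOneSpectrum (𝓞 K))} (_hS : S.Finite)
      {β : SatakeFamily K} (_hβ : IsSatakeFamilyOf Q S β) (s₀ : ℂ)
      (νA : Measure (Fin n → ideleGroup K)) (_ : IsHaarMeasure νA)
      (νK : Measure ↥(maximalCompactAdelic n K)) (_ : IsHaarMeasure νK)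
      (ν₀ : Measure ↥(adelicUnipotent n K)) (_ : IsHaarMeasure ν₀),
      ∃ (T : Finset (HeightOneSpectrum (𝓞 K))) (k : ℕ) (f f' : Fin k → Q.1.toSubmodule)
      (η : Fin k → (AdelicGroupData.gl n K).Adelic → ℝ) (𝔫 : Fin k → Ideal (𝓞 K))
      (Φ : Fin k → (Fin n → AdeleRing (𝓞 K) K) → ℝ) (c : Fin k → ℂ → ℂ) (A H : ℂ → ℂ),
      (∀ v ∈ T, v ∉ S) ∧
      (∀ v ∉ S, v ∉ T → ¬ v.asIdeal ∣ differentIdeal ℤ (𝓞 K)) ∧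
      (∀ i, IsTestFunctionGL n K (η i)) ∧ (∀ i, 𝔫 i ≠ 0) ∧
      (∀ i (u : (AdelicGroupData.gl n K).Adelic), u ∈ principalCongruenceLevel n K (𝔫 i) →
      ∀ g : (AdelicGroupData.gl n K).Adelic, η i (u * g) = η i g) ∧
      (∀ i, ∀ v ∉ S, v ∉ T → ¬ v.asIdeal ∣ 𝔫 i) ∧
      (∀ i, Continuous (Φ i)) ∧ (∀ i y, 0 ≤ Φ i y) ∧
      (∀ i, (fun y => ((Φ i y : ℝ) : ℂ)) ∈ piSchwartzBruhat K (Fin n)) ∧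
      (∀ i, ∀ v ∉ S ∪ ↑T, IsLastRowSphericalAt n K (Φ i) v) ∧
      (∀ i, ∀ v ∉ S ∪ ↑T, ∀ y : Fin n → AdeleRing (𝓞 K) K, Φ i y ≠ 0 → ∀ j, Valued.v ((y j).2 v) ≤ 1) ∧
      (∀ i, Differentiable ℂ (c i)) ∧ Differentiable ℂ A ∧ Differentiable ℂ H ∧ A s₀ ≠ 0 ∧
      ∀ s : ℂ, 1 < s.re →
      H s * ∑ i, c i s * ∫ p in unitBox {v | v ∉ S ∪ ↑T} ×ˢ Set.univ, torusPairIntegrandC n K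
      (whittakerCoeff ν₀ (unipotentTateDomain n K) (adeleAddChar K)
      (invQuot (AdelicGroupData.gl n K) (smoothedForm (η i) (f i : (AdelicGroupData.gl n K).L2 μ))))
      (star (whittakerCoeff ν₀ (unipotentTateDomain n K) (adeleAddChar K)
      (invQuot (AdelicGroupData.gl n K) (smoothedForm (η i) (f' i : (AdelicGroupData.gl n K).L2 μ)))))
      (Φ i) s p ∂(νA.prod νK) =
      A s * ∏ v ∈ T, ((satakePairPolynomial (β v) ((β v).map conj)).eval
      ((v.residueCard : ℂ) ^ (-s)))⁻¹) →
      MoeglinWaldspurger1989_partialPairL_of_eq_conj (n := n) (K := K) (μ := μ) := by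
  intro hG n K _ _ μ _ hloc hn P P' he S hS α β hα hβ
  refine exists_entire_eq_mul_partialPairL_of_quotients_on_strip he hα hβ fun s₀ => ?_
  classical
  -- topological and measurable structures
  haveI : T2Space (GL (Fin n) (AdeleRing (𝓞 K) K)) := t2Space_gl n K
  haveI : LocallyCompactSpace (GL (Fin n) (AdeleRing (𝓞 K) K)) :=
    AdelicGroupData.locallyCompactSpace_generalLinearGroup_adeleRing K (Fin n)
  haveI := secondCountableTopology_generalLinearGroup_adeleRing K (Fin n)
  haveI : T2Space (AdeleRing (𝓞 K) K) := t2Space_adeleRing K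
  letI : MeasurableSpace (AdeleRing (𝓞 K) K) := borel _
  haveI : BorelSpace (AdeleRing (𝓞 K) K) := ⟨rfl⟩
  haveI := borelSpace_ideleGroup K
  haveI := locallyCompactSpace_ideleGroup K
  haveI := secondCountableTopology_ideleGroup K
  haveI := secondCountableTopology_adeleRing K
  haveI := locallyCompactSpace_adeleRing' K
  haveI : CompactSpace ↥(maximalCompactAdelic n K) :=
    isCompact_iff_compactSpace.1 (isCompact_maximalCompactAdelic n K)
  haveI : LocallyCompactSpace ↥(adelicUnipotent n K) := (isClosed_adelicUnipotent n K).locallyCompactSpace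
  -- Haar measures
  obtain ⟨νI, hνI⟩ := exists_isHaarMeasure_ideleGroup K
  set νA : Measure (Fin n → ideleGroup K) := Measure.haar with hνA
  set νK : Measure ↥(maximalCompactAdelic n K) := Measure.haar with hνK
  set ν₀ : Measure ↥(adelicUnipotent n K) := Measure.haar with hν₀
  -- the local data (general test functions `Φ_i`) for `σ = P'`
  obtain ⟨T, k, f, f', η, 𝔫, Φ, c, A, H, hTS, h𝔡T, hη, h𝔫, hηK, h𝔫T, hΦc, hΦ0, hΦS, hΦsph, hΦv, hc, hA, hH,
      hA0, hsum⟩ :=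
    hloc P' hS hβ s₀ νA inferInstance νK inferInstance ν₀ inferInstance
  -- the global Rankin–Selberg method (general test function) for each pair `(f_i, f'_i)` off `S' = S ∪ T`
  obtain ⟨C, hC, hF⟩ := hG hn μ νI νA νK ν₀
  have hSS' : S ⊆ S ∪ (↑T : Set (HeightOneSpectrum (𝓞 K))) := subset_union_left
  have hβ' : IsSatakeFamilyOf P' (S ∪ ↑T) β := hβ.mono hSS'
  have hGood : ∀ i, ∀ v ∉ S ∪ (↑T : Set (HeightOneSpectrum (𝓞 K))),
      ¬ v.asIdeal ∣ 𝔫 i ∧ ¬ v.asIdeal ∣ differentIdeal ℤ (𝓞 K) := by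
    intro i v hv
    simp only [Set.mem_union, Finset.mem_coe, not_or] at hv
    exact ⟨h𝔫T i v hv.1 hv.2, h𝔡T v hv.1 hv.2⟩
  -- an enumeration of the Satake parameters off `S ∪ T`
  have hex : ∀ v : HeightOneSpectrum (𝓞 K), ∃ x : Fin n → ℂ,
      v ∉ S ∪ (↑T : Set (HeightOneSpectrum (𝓞 K))) → (Finset.univ : Finset (Fin n)).val.map x = β v := by
    intro v
    by_cases hv : v ∉ S ∪ (↑T : Set (HeightOneSpectrum (𝓞 K)))
    · obtain ⟨x, hx⟩ := exists_univ_val_map_eq (hβ'.card_eq hv)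
      exact ⟨x, fun _ => hx⟩
    · exact ⟨fun _ => 0, fun h => absurd h hv⟩
  choose x hx using hex
  have hdata : ∀ i : Fin k, ∃ F : ℂ → ℂ, Differentiable ℂ F ∧
      ∀ s : ℂ, 1 < s.re → s.re < 2 → F s = s * (s - 1) * ((C : ℂ) *
        (partialPairL (S ∪ ↑T) β (fun v => (β v).map conj) s *
          ∫ p in unitBox {v | v ∉ S ∪ ↑T} ×ˢ Set.univ, torusPairIntegrandC n K
            (whittakerCoeff ν₀ (unipotentTateDomain n K) (adeleAddChar K)
              (invQuot (gl n K) (smoothedForm (η i) (f i : (gl n K).L2 μ))))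
            (star (whittakerCoeff ν₀ (unipotentTateDomain n K) (adeleAddChar K)
              (invQuot (gl n K) (smoothedForm (η i) (f' i : (gl n K).L2 μ)))))
            (Φ i) s p ∂(νA.prod νK))) := by
    intro i
    obtain ⟨F, hFd, -, hFstrip⟩ := hF P' P' (f i) (f' i) (P'.exists_central_scalar (f i) (f' i)) hβ hβ
      (h𝔫 i) (hη i) (hηK i) hSS' (hGood i) (fun v hv => hx v hv) (fun v hv => hx v hv) (hΦc i) (hΦ0 i) (hΦS i)
      (hΦsph i) (hΦv i)
    exact ⟨F, hFd, hFstrip⟩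
  choose F hFd hFI using hdata
  -- the change of `S`: `L^S(α ⊗ β) = (∏_{v ∈ T} L_v) · L^{S ∪ T}(β ⊗ β̄)`
  have hfinT : ((S ∪ (↑T : Set (HeightOneSpectrum (𝓞 K)))) \ S).Finite :=
    T.finite_toSet.subset fun v hv => hv.1.resolve_left hv.2
  have hTeq : hfinT.toFinset = T := by
    ext v
    rw [Set.Finite.mem_toFinset, Set.mem_sdiff, Set.mem_union, Finset.mem_coe]
    constructor
    · rintro ⟨h | h, hvS⟩
      · exact absurd h hvS
      · exact h
    · exact fun h => ⟨Or.inr h, hTS v h⟩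
  have hL : ∀ s : ℂ, 1 < s.re → partialPairL S α β s =
      (∏ v ∈ T, ((satakePairPolynomial (β v) ((β v).map conj)).eval ((v.residueCard : ℂ) ^ (-s)))⁻¹) *
        partialPairL (S ∪ ↑T) β (fun v => (β v).map conj) s := by
    intro s hs
    have hmul : Multipliable fun v : {v : HeightOneSpectrum (𝓞 K) // v ∉ S ∪ (↑T : Set (HeightOneSpectrum (𝓞 K)))} =>
        ((satakePairPolynomial (β v.1) (conjFamily β v.1)).eval ((v.1.residueCard : ℂ) ^ (-s)))⁻¹ :=
      JacquetShalika1981_multipliable_partialPairL_holds P' P'.conj hβ' hβ'.conj hs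
    rw [partialPairL_eq_partialPairL_conjFamily_of_eq_conj he hα hβ, partialPairL_comm,
      partialPairL_eq_prod_mul_partialPairL hSS' hfinT β (conjFamily β) hmul, hTeq]
    rfl
  -- `J = H · ∑_i c_i F_i`, `A' = C A`
  refine ⟨fun s => H s * ∑ i, c i s * F i s, fun s => (C : ℂ) * A s,
    hH.mul (Differentiable.fun_sum fun i _ => (hc i).mul (hFd i)),
    (differentiable_const _).mul hA, mul_ne_zero (Complex.ofReal_ne_zero.2 hC.ne') hA0, fun s hs1 hs2 => ?_⟩
  have hSumF : ∑ i, c i s * F i s = s * (s - 1) * ((C : ℂ) * (partialPairL (S ∪ ↑T) β (fun v => (β v).map conj) s *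
      ∑ i, c i s * ∫ p in unitBox {v | v ∉ S ∪ ↑T} ×ˢ Set.univ, torusPairIntegrandC n K
        (whittakerCoeff ν₀ (unipotentTateDomain n K) (adeleAddChar K)
          (invQuot (gl n K) (smoothedForm (η i) (f i : (gl n K).L2 μ))))
        (star (whittakerCoeff ν₀ (unipotentTateDomain n K) (adeleAddChar K)
          (invQuot (gl n K) (smoothedForm (η i) (f' i : (gl n K).L2 μ)))))
        (Φ i) s p ∂(νA.prod νK))) := by
    simp only [Finset.mul_sum]
    exact Finset.sum_congr rfl fun i _ => by rw [hFI i s hs1 hs2]; ring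
  show H s * ∑ i, c i s * F i s = (C : ℂ) * A s * (s * (s - 1) * partialPairL S α β s)
  rw [hSumF, hL s hs1]
  calc H s * (s * (s - 1) * ((C : ℂ) * (partialPairL (S ∪ ↑T) β (fun v => (β v).map conj) s *
        ∑ i, c i s * ∫ p in unitBox {v | v ∉ S ∪ ↑T} ×ˢ Set.univ, torusPairIntegrandC n K
          (whittakerCoeff ν₀ (unipotentTateDomain n K) (adeleAddChar K)
            (invQuot (gl n K) (smoothedForm (η i) (f i : (gl n K).L2 μ))))
          (star (whittakerCoeff ν₀ (unipotentTateDomain n K) (adeleAddChar K)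
            (invQuot (gl n K) (smoothedForm (η i) (f' i : (gl n K).L2 μ)))))
          (Φ i) s p ∂(νA.prod νK))))
      = s * (s - 1) * (C : ℂ) * partialPairL (S ∪ ↑T) β (fun v => (β v).map conj) s *
          (H s * ∑ i, c i s * ∫ p in unitBox {v | v ∉ S ∪ ↑T} ×ˢ Set.univ, torusPairIntegrandC n K
            (whittakerCoeff ν₀ (unipotentTateDomain n K) (adeleAddChar K)
              (invQuot (gl n K) (smoothedForm (η i) (f i : (gl n K).L2 μ))))
            (star (whittakerCoeff ν₀ (unipotentTateDomain n K) (adeleAddChar K)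
              (invQuot (gl n K) (smoothedForm (η i) (f' i : (gl n K).L2 μ)))))
            (Φ i) s p ∂(νA.prod νK)) := by ring
    _ = s * (s - 1) * (C : ℂ) * partialPairL (S ∪ ↑T) β (fun v => (β v).map conj) s *
          (A s * ∏ v ∈ T, ((satakePairPolynomial (β v) ((β v).map conj)).eval
            ((v.residueCard : ℂ) ^ (-s)))⁻¹) := by rw [hsum s hs1]
    _ = (C : ℂ) * A s * (s * (s - 1) *
          ((∏ v ∈ T, ((satakePairPolynomial (β v) ((β v).map conj)).eval ((v.residueCard : ℂ) ^ (-s)))⁻¹) *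
            partialPairL (S ∪ ↑T) β (fun v => (β v).map conj) s)) := by ring

end Summit.Langlands.Langlands.Theorems.EqConjOfLocalGen
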